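import Summits.ResolutionOfSingularities.ResolutionOfSingularities.Theorems.WeightedInvariantIota3RatioOneDominance
import Summits.ResolutionOfSingularities.ResolutionOfSingularities.Theorems.WeightedInvariantJFlatEssSmoothAssembly
import Literature.AlgebraicGeometry.Resolution.QuadraticTransformsUFD
import Mathlib.RingTheory.Valuation.ValuationRing
import HarnessLib

/-!
# Dominance word, RATIO-ONE REGIME `r₁ = r₂ = r > q` (memo (6b) of res-D-brk-1's O70B-JCAN-PLAN), PART 3 — ARBITRARY TWO-FLAGS and
# the regime IN THE BINDER SHAPE of `Iota3.TwoFlagDominanceAtLevelAt`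
# (door `HypersurfaceCentreConstruction`, stmt-ResolutionOfSingularities-19897; P3 rung clause h8 ⟸ (σ-pres)₃ ⟸ the ONE dominance word
# `TwoFlagDominanceAtLevelLE3Body p`, regime `a = b`)

Topic: `Summits/ResolutionOfSingularities/ResolutionOfSingularities/Theorems`. Helper for the door item `HypersurfaceCentreConstruction`
(stmt-ResolutionOfSingularities-19897, route `WeightedInvariant`), line `local-engine`, def-free.  PART 2 (…Iota3RatioOneDominance) proved
the core lemma for two reaching flags WITH A COMMON SECOND MEMBER.  THIS FILE removes that restriction and states the result in the exact
binder shape of the dominance word: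

* `Iota3.exists_sub_mul_mem_span_pair_of_isTwoFlag` — for a two-flag `(g₁', g₂')` of a regular local ring of dimension `3` the quotient
  `S ⧸ (g₁', g₂')` is regular local of dimension `1` (Matsumura 14.2, tree `IsRsopPart`), hence a principal valuation ring, so for any
  `a, b`: `b ≡ e·a` or `a ≡ e·b` modulo `(g₁', g₂')`;
* `Iota3.isTwoFlag_sub_mul`, `Iota3.flagContactFiltration_sub_mul_eq`, `Iota3.flagContactFiltration_swap_eq` — the `(q; r, r)`-filtration of
  a two-flag depends only on the flag up to `g₂ ↦ g₂ − e g₁` and swapping (mutual dominance, `flagContactFiltration_eq_of_mem_of_mem`);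
* `Iota3.exists_isTwoFlag_of_mem_span_pair` — a member `w ∉ 𝔪²` of `(g₁', g₂')` is part of a generating two-flag `(y', w)` with the same
  filtration;
* **`Iota3.dominance_ratio_one`** — `0 < q ≤ r`, two two-flags both carrying `f` to level `rν` of their `(q; r, r)`-filtrations, and
  `f ∉ (ℓ^ν) + 𝔪^{ν+1}` for all `ℓ ∈ 𝔪` ⇒ `g₁', g₂' ∈ F_{(g₁,g₂)}(r)`: the common member `w = g₂ − e g₁ ∈ (g₁', g₂')` (or the swapped one)
  from the DVR, then PART 2;
* `Iota3.exists_isTwoFlag_of_not_mem_sq` — every `ℓ ∈ 𝔪 ∖ 𝔪²` is the first member of a two-flag (cotangent space of dimension `3`);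
* **`Iota3.dominanceAtLevel_of_r₁_eq_r₂`** — THE RATIO-ONE REGIME OF `TwoFlagDominanceAtLevelAt f` in its binder shape: under the ratio
  bound `∀ reached admissible (q'; r₁', r₂'), r₁' b ≤ a r₂'` (`0 < b`), a triple with `r₁ b = a r₂` and `r₁ = r₂`, and two reaching
  two-flags, the dominance conclusion holds (the bound gives `f ∉ (ℓ^ν) + 𝔪^{ν+1}`: else `(ℓ, ·)` reaches `(ν; ν+1, ν)` of ratio `> 1`).
So the word `TwoFlagDominanceAtLevelAt f` (at any `0 ≠ f ∈ 𝔪` of a regular local ring of dimension `3`) is reduced to its regime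
`r₂ < r₁` — PART 1 `r₂ = q` (p564416), (E1) (…JSigmaDominanceSecondMember) and the residue `q < r₂ < r₁` of the memo (§5–§7, OPEN).

[OURS · L1 W4.3 · (o70-b)/(Δ12) §6b]  Replaces the role of NO printed item; NOT a statement of the manuscript [claim: Hironaka2017,
status: under-review]. AI work, weaker than expert review.  Pure commutative algebra; no named facts; no definition.

## References

* H. Matsumura, *Commutative Ring Theory* (1987), Thm. 2.3, Thm. 11.2, Thm. 14.2. [Matsumura1987]
* V. Cossart, U. Jannsen, S. Saito, LNM 2270 (2020), Def. 8.2, Lemma 8.3. [CossartJannsenSaito2020]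
* res-D-brk-1, `D/res-D-brk-1/O70B-JCAN-PLAN.md` §6b (OURS, AI analysis, 2026-08-27).
-/

noncomputable section

set_option linter.dupNamespace false -- mandated namespace `Summit.<Summit>.<Problem>` of this single-conjunct summit

open IsLocalRing Literature.AlgebraicGeometry.Resolution
open Summit.ResolutionOfSingularities.ResolutionOfSingularities.Theorems

namespace Summit.ResolutionOfSingularities.ResolutionOfSingularities.Cruxes.HypersurfaceCentreConstruction.LocalEngine

namespace Iota3

/-! ## §6 From two arbitrary two-flags to a common second member, and the ratio-one regime of the dominance word -/

section Flags

variable {S : Type} [CommRing S] [IsRegularLocalRing S]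

/-- `Set.range ![a, b] = {a, b}`. [folklore] -/
theorem range_vec₂ {R : Type} (a b : R) : Set.range ![a, b] = {a, b} := by
  rw [Matrix.range_cons, Matrix.range_cons, Matrix.range_empty, Set.union_empty, Set.singleton_union]

/-- **Divisibility in the DVR `S ⧸ (g₁', g₂')`.**  For a two-flag `(g₁', g₂')` of a regular local ring of dimension `3` (so that
`S ⧸ (g₁', g₂')` is regular local of dimension `1`, a discrete valuation ring) and any `a, b ∈ S`: `b ≡ e·a` or `a ≡ e·b` modulo
`(g₁', g₂')` for some `e`. [cite: Matsumura1987, Thm. 14.2 and Thm. 11.2] -/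
theorem exists_sub_mul_mem_span_pair_of_isTwoFlag (hdim : ringKrullDim S = (3 : ℕ)) {g₁' g₂' : S}
    (hΦ' : IsTwoFlag g₁' g₂') (a b : S) :
    ∃ e : S, b - e * a ∈ Ideal.span {g₁', g₂'} ∨ a - e * b ∈ Ideal.span {g₁', g₂'} := by
  classical
  set u : Fin 2 → S := ![g₁', g₂'] with hu
  have hum : ∀ i, u i ∈ maximalIdeal S := by
    intro i
    fin_cases i
    · exact hΦ'.1
    · exact hΦ'.2.1
  have hli : LinearIndependent (ResidueField S) fun i => (maximalIdeal S).toCotangent ⟨u i, hum i⟩ := by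
    convert hΦ'.linearIndependent_toCotangent using 1
    ext i
    fin_cases i <;> rfl
  have hrsop : IsRsopPart u := JFlatEssSmooth.isRsopPart_of_linearIndependent_toCotangent u hum hli
  have hspan : Ideal.span (Set.range u) = Ideal.span {g₁', g₂'} := by rw [hu, range_vec₂]
  haveI hreg : IsRegularLocalRing (S ⧸ Ideal.span (Set.range u)) := hrsop.isRegularLocalRing_quotient
  have hdimD : ringKrullDim (S ⧸ Ideal.span (Set.range u)) = 1 := by
    have h := hrsop.ringKrullDim_quotient_add
    rw [hdim] at h
    exact JFlatEssSmooth.eq_one_of_add_two_eq (by exact_mod_cast h)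
  haveI := isDomain_of_isRegularLocalRing (S ⧸ Ideal.span (Set.range u))
  haveI : IsPrincipalIdealRing (S ⧸ Ideal.span (Set.range u)) := isPrincipalIdealRing_of_ringKrullDim_le_one hdimD.le
  haveI : ValuationRing (S ⧸ Ideal.span (Set.range u)) := inferInstance
  obtain ⟨c, hc⟩ := ValuationRing.cond (Ideal.Quotient.mk (Ideal.span (Set.range u)) a)
    (Ideal.Quotient.mk (Ideal.span (Set.range u)) b)
  obtain ⟨e, rfl⟩ := Ideal.Quotient.mk_surjective c
  refine ⟨e, ?_⟩
  rw [← hspan]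
  rcases hc with h | h
  · left
    rw [← map_mul, eq_comm, Ideal.Quotient.eq] at h
    have : b - e * a = b - a * e := by ring
    rwa [this]
  · right
    rw [← map_mul, eq_comm, Ideal.Quotient.eq] at h
    have : a - e * b = a - b * e := by ring
    rwa [this]

/-- Replacing the second member `g₂` of a two-flag `(y, g₂)` by `g₂ − e·y` gives a two-flag with the SAME `(q; r, r)`-filtration
(mutual dominance, `flagContactFiltration_eq_of_mem_of_mem`). [folklore] -/
theorem isTwoFlag_sub_mul {y g₂ : S} (hΦ : IsTwoFlag y g₂) (e : S) : IsTwoFlag y (g₂ - e * y) := by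
  refine ⟨hΦ.1, Ideal.sub_mem _ hΦ.2.1 (Ideal.mul_mem_left _ e hΦ.1), fun a b hab => ?_⟩
  have h := hΦ.2.2 (a - b * e) b (by
    have : (a - b * e) * y + b * g₂ = a * y + b * (g₂ - e * y) := by ring
    rw [this]
    exact hab)
  refine ⟨?_, h.2⟩
  have : a = (a - b * e) + b * e := by ring
  rw [this]
  exact Ideal.add_mem _ h.1 (Ideal.mul_mem_right _ _ h.2)

/-- The `(q; r, r)`-filtrations of `(y, g₂)` and `(y, g₂ − e·y)` coincide. [folklore] -/
theorem flagContactFiltration_sub_mul_eq {y g₂ : S} (e : S) {q : ℕ} (hq : 0 < q) (r n : ℕ) :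
    flagContactFiltration y (g₂ - e * y) q r r n = flagContactFiltration y g₂ q r r n := by
  have hs := self_mem_flagContactFiltration y g₂ r r hq
  have hs' := self_mem_flagContactFiltration y (g₂ - e * y) r r hq
  refine flagContactFiltration_eq_of_mem_of_mem hq hs.1 (Ideal.sub_mem _ hs.2 (Ideal.mul_mem_left _ e hs.1)) hs'.1 ?_ n
  have h := Ideal.add_mem _ hs'.2 (Ideal.mul_mem_left _ e hs'.1)
  rwa [sub_add_cancel] at h

/-- The `(q; r, r)`-filtration is symmetric in the flag. [folklore] -/
theorem flagContactFiltration_swap_eq (g₁ g₂ : S) {q : ℕ} (hq : 0 < q) (r n : ℕ) :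
    flagContactFiltration g₂ g₁ q r r n = flagContactFiltration g₁ g₂ q r r n := by
  have hs := self_mem_flagContactFiltration g₁ g₂ r r hq
  have hs' := self_mem_flagContactFiltration g₂ g₁ r r hq
  exact flagContactFiltration_eq_of_mem_of_mem hq hs.2 hs.1 hs'.2 hs'.1 n

/-- **A member `w ∉ 𝔪²` of the ideal of a two-flag `(g₁', g₂')` is part of a generating two-flag `(y', w)` with the same filtration**:
`y' ∈ {g₁', g₂'}`, `(y', w)` a two-flag, and `F_{(y',w)} = F_{(g₁',g₂')}` levelwise. [folklore] -/
theorem exists_isTwoFlag_of_mem_span_pair {g₁' g₂' w : S} (hΦ' : IsTwoFlag g₁' g₂') (hw : w ∈ Ideal.span {g₁', g₂'})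
    (hw2 : w ∉ maximalIdeal S ^ 2) {q : ℕ} (hq : 0 < q) (r : ℕ) :
    ∃ y' : S, IsTwoFlag y' w ∧ ∀ n, flagContactFiltration y' w q r r n = flagContactFiltration g₁' g₂' q r r n := by
  obtain ⟨s, t, hst⟩ := Ideal.mem_span_pair.mp hw
  -- not both coefficients in `𝔪`
  have hunit : IsUnit s ∨ IsUnit t := by
    by_contra h
    rw [not_or] at h
    apply hw2
    rw [← hst, pow_two]
    exact Ideal.add_mem _ (Ideal.mul_mem_mul ((IsLocalRing.mem_maximalIdeal _).mpr h.1) hΦ'.1)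
      (Ideal.mul_mem_mul ((IsLocalRing.mem_maximalIdeal _).mpr h.2) hΦ'.2.1)
  have hwm : w ∈ maximalIdeal S := by
    rw [← hst]
    exact Ideal.add_mem _ (Ideal.mul_mem_left _ s hΦ'.1) (Ideal.mul_mem_left _ t hΦ'.2.1)
  have hsF := self_mem_flagContactFiltration g₁' g₂' r r hq
  have hwF : w ∈ flagContactFiltration g₁' g₂' q r r r := by
    rw [← hst]
    exact Ideal.add_mem _ (Ideal.mul_mem_left _ s hsF.1) (Ideal.mul_mem_left _ t hsF.2)
  rcases hunit with hs | ht
  · -- `s` a unit: `y' := g₂'`, `g₁' = s⁻¹ (w − t g₂')`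
    obtain ⟨s', hs'⟩ := hs.exists_left_inv
    refine ⟨g₂', ⟨hΦ'.2.1, hwm, fun a b hab => ?_⟩, fun n => ?_⟩
    · have h := hΦ'.2.2 (b * s) (a + b * t) (by
        have : b * s * g₁' + (a + b * t) * g₂' = a * g₂' + b * w := by rw [← hst]; ring
        rw [this]
        exact hab)
      have hb : b ∈ maximalIdeal S := by
        have : b = s' * (b * s) := by rw [mul_comm b s, ← mul_assoc, hs', one_mul]
        rw [this]
        exact Ideal.mul_mem_left _ _ h.1
      refine ⟨?_, hb⟩
      have : a = (a + b * t) - b * t := by ring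
      rw [this]
      exact Ideal.sub_mem _ h.2 (Ideal.mul_mem_right _ _ hb)
    · have hsF' := self_mem_flagContactFiltration g₂' w r r hq
      refine flagContactFiltration_eq_of_mem_of_mem hq hsF.2 hwF ?_ hsF'.1 n
      have : g₁' = s' * (w - t * g₂') := by
        have h1 : s' * (s * g₁') = g₁' := by rw [← mul_assoc, hs', one_mul]
        rw [← h1, ← hst]
        ring
      rw [this]
      exact Ideal.mul_mem_left _ _ (Ideal.sub_mem _ hsF'.2 (Ideal.mul_mem_left _ t hsF'.1))
  · -- `t` a unit: `y' := g₁'`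
    obtain ⟨t', ht'⟩ := ht.exists_left_inv
    refine ⟨g₁', ⟨hΦ'.1, hwm, fun a b hab => ?_⟩, fun n => ?_⟩
    · have h := hΦ'.2.2 (a + b * s) (b * t) (by
        have : (a + b * s) * g₁' + b * t * g₂' = a * g₁' + b * w := by rw [← hst]; ring
        rw [this]
        exact hab)
      have hb : b ∈ maximalIdeal S := by
        have : b = t' * (b * t) := by rw [mul_comm b t, ← mul_assoc, ht', one_mul]
        rw [this]
        exact Ideal.mul_mem_left _ _ h.2
      refine ⟨?_, hb⟩
      have : a = (a + b * s) - b * s := by ring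
      rw [this]
      exact Ideal.sub_mem _ h.1 (Ideal.mul_mem_right _ _ hb)
    · have hsF' := self_mem_flagContactFiltration g₁' w r r hq
      refine flagContactFiltration_eq_of_mem_of_mem hq hsF.1 hwF hsF'.1 ?_ n
      have : g₂' = t' * (w - s * g₁') := by
        have h1 : t' * (t * g₂') = g₂' := by rw [← mul_assoc, ht', one_mul]
        rw [← h1, ← hst]
        ring
      rw [this]
      exact Ideal.mul_mem_left _ _ (Ideal.sub_mem _ hsF'.2 (Ideal.mul_mem_left _ s hsF'.1))

/-- **RATIO-ONE DOMINANCE FOR ARBITRARY TWO-FLAGS** (regular local, dimension `3`): if `0 < q ≤ r`, `f` lies in level `rν` of the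
`(q; r, r)`-filtrations of two two-flags `(g₁, g₂)` and `(g₁', g₂')`, and `f ∉ (ℓ^ν) + 𝔪^{ν+1}` for every `ℓ ∈ 𝔪` (the tangent form of
`f` is not a `ν`-th power of a linear form — the content of the maximal-ratio clause at ratio `1`), then
`g₁', g₂' ∈ F_{(g₁,g₂)}(r) = (g₁, g₂) + 𝔪^⌈r/q⌉`.  Reduction to the common-member core lemma through the DVR `S ⧸ (g₁', g₂')`.
[OURS · L1 W4.3 · (o70-b) §6b] -/
theorem dominance_ratio_one (hdim : ringKrullDim S = (3 : ℕ)) {f : S} {ν : ℕ}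
    (hNP : ∀ ℓ ∈ maximalIdeal S, f ∉ Ideal.span {ℓ ^ ν} ⊔ maximalIdeal S ^ (ν + 1))
    {g₁ g₂ g₁' g₂' : S} {q r : ℕ} (hq : 0 < q) (hqr : q ≤ r)
    (hΦ : IsTwoFlag g₁ g₂) (hΦ' : IsTwoFlag g₁' g₂')
    (hF : f ∈ flagContactFiltration g₁ g₂ q r r (r * ν)) (hF' : f ∈ flagContactFiltration g₁' g₂' q r r (r * ν)) :
    g₁' ∈ flagContactFiltration g₁ g₂ q r r r ∧ g₂' ∈ flagContactFiltration g₁ g₂ q r r r := by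
  rcases hqr.eq_or_lt with rfl | hqr'
  · exact ⟨maximalIdeal_le_flagContactFiltration g₁ g₂ q q hq hΦ'.1, maximalIdeal_le_flagContactFiltration g₁ g₂ q q hq hΦ'.2.1⟩
  -- the packaged common-member argument, for a flag `(y, z)` with `z − e y ∈ (g₁', g₂')`
  have key : ∀ {y z : S} (e : S), IsTwoFlag y z → z - e * y ∈ Ideal.span {g₁', g₂'} →
      f ∈ flagContactFiltration y z q r r (r * ν) →
      g₁' ∈ flagContactFiltration y z q r r r ∧ g₂' ∈ flagContactFiltration y z q r r r := by
    intro y z e hyz hwI hFyz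
    set w := z - e * y with hw
    have hyw : IsTwoFlag y w := isTwoFlag_sub_mul hyz e
    have hw2 : w ∉ maximalIdeal S ^ 2 := hyw.symm.left_not_mem_sq
    -- `(y', w)` generating `(g₁', g₂')` with the same filtration
    obtain ⟨y', hy'w, hFeq⟩ := exists_isTwoFlag_of_mem_span_pair hΦ' hwI hw2 hq r
    -- a completing parameter for `(y, w)`
    obtain ⟨x, hx, -⟩ := exists_span_triple_of_isTwoFlag S hdim y w hyw
    -- the core lemma with the roles `Y := y'`, `(Y', w) := (y, w)`
    have hFyw : f ∈ flagContactFiltration y w q r r (r * ν) := by rwa [hw, flagContactFiltration_sub_mul_eq e hq]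
    have hFy'w : f ∈ flagContactFiltration y' w q r r (r * ν) := by rw [hFeq]; exact hF'
    have hy' : y' ∈ flagContactFiltration y w q r r r :=
      mem_weight_of_reaches_ratio_one_of_common hdim hx hy'w hq hqr' hFy'w hFyw (hNP w hyw.2.1)
    have hwF : w ∈ flagContactFiltration y w q r r r := (self_mem_flagContactFiltration y w r r hq).2
    -- `(g₁', g₂') = (y', w) ⊆ F_{(y,w)}(r) = F_{(y,z)}(r)`
    have hle : flagContactFiltration y' w q r r r ≤ flagContactFiltration y w q r r r :=
      flagContactFiltration_le_of_mem hq hy' hwF r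
    have hs := self_mem_flagContactFiltration g₁' g₂' r r hq
    rw [← hFeq r] at hs
    rw [hw, flagContactFiltration_sub_mul_eq e hq] at hle
    exact ⟨hle hs.1, hle hs.2⟩
  obtain ⟨e, he | he⟩ := exists_sub_mul_mem_span_pair_of_isTwoFlag hdim hΦ' g₁ g₂
  · exact key e hΦ he hF
  · have h := key e hΦ.symm he (by rwa [flagContactFiltration_swap_eq g₁ g₂ hq])
    rwa [flagContactFiltration_swap_eq g₁ g₂ hq] at h

end Flags

/-! ## §7 The ratio-one regime of the dominance word, in the binder shape of `TwoFlagDominanceAtLevelAt` -/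

section Word

variable {S : Type} [CommRing S] [IsRegularLocalRing S]

open Module in
/-- **An element of `𝔪 ∖ 𝔪²` is the first member of a two-flag** (regular local ring of dimension `3`: pick a cotangent vector off the
line of `ℓ̄` and lift it). [cite: Matsumura1987, Thm. 2.3] -/
theorem exists_isTwoFlag_of_not_mem_sq (hdim : ringKrullDim S = (3 : ℕ)) {ℓ : S} (hℓ : ℓ ∈ maximalIdeal S)
    (hℓ2 : ℓ ∉ maximalIdeal S ^ 2) : ∃ g : S, IsTwoFlag ℓ g := by
  classical
  set v : CotangentSpace S := (maximalIdeal S).toCotangent ⟨ℓ, hℓ⟩ with hv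
  have hv0 : v ≠ 0 := fun h => hℓ2 (((maximalIdeal S).toCotangent_eq_zero ⟨ℓ, hℓ⟩).mp h)
  have hdim' : ringKrullDim S = 3 := by rw [hdim]; rfl
  have h3 : (maximalIdeal S).spanFinrank = 3 := spanFinrank_eq_three_of_ringKrullDim hdim'
  have hfin : finrank (ResidueField S) (CotangentSpace S) = 3 := by
    rw [← spanFinrank_maximalIdeal_eq_finrank_cotangentSpace]
    exact h3
  have hlt : Submodule.span (ResidueField S) ({v} : Set (CotangentSpace S)) ≠ ⊤ := by
    intro htop
    have h1 := finrank_span_le_card (R := ResidueField S) ({v} : Set (CotangentSpace S))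
    rw [htop, finrank_top, hfin, Set.toFinset_singleton, Finset.card_singleton] at h1
    omega
  obtain ⟨w, -, hw⟩ := SetLike.exists_of_lt (lt_top_iff_ne_top.mpr hlt)
  obtain ⟨gm, hgm⟩ := (maximalIdeal S).toCotangent_surjective w
  refine ⟨(gm : S), hℓ, gm.2, fun a b hab => ?_⟩
  have hli : LinearIndependent (ResidueField S) ![v, w] := by
    rw [LinearIndependent.pair_iff' hv0]
    intro c hc
    exact hw (hc ▸ Submodule.smul_mem _ c (Submodule.mem_span_singleton_self v))
  have h1 : (maximalIdeal S).toCotangent (a • ⟨ℓ, hℓ⟩ + b • gm) = 0 := by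
    rw [Ideal.toCotangent_eq_zero]
    simpa [Submodule.coe_add, Submodule.coe_smul, smul_eq_mul] using hab
  rw [map_add, map_smul, map_smul, hgm] at h1
  obtain ⟨ha, hb⟩ := (LinearIndependent.pair_iff.mp hli) (Ideal.Quotient.mk _ a) (Ideal.Quotient.mk _ b) h1
  exact ⟨Ideal.Quotient.eq_zero_iff_mem.mp ha, Ideal.Quotient.eq_zero_iff_mem.mp hb⟩

/-- **THE RATIO-ONE REGIME OF THE DOMINANCE WORD `TwoFlagDominanceAtLevelAt f`, in its binder shape** (regular local ring of
dimension `3`, `0 ≠ f ∈ 𝔪`): under the ratio bound `∀ reached admissible (q'; r₁', r₂'), r₁' b ≤ a r₂'` (`0 < b`), for a triple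
`(q; r₁, r₂)` with `r₁ b = a r₂` AND `r₁ = r₂`, two two-flags carrying `f` to level `r₁ν` (`ν = ord f`) dominate each other.  (The bound
forces `f ∉ (ℓ^ν) + 𝔪^{ν+1}` for every `ℓ ∈ 𝔪`: otherwise `(ℓ, ·)` reaches `(ν; ν+1, ν)`, of ratio `> 1 = a/b`.)  The regimes `r₂ < r₁` of
the word (PART 1 `r₂ = q`, p564416; (E1); the residue `q < r₂ < r₁`) are NOT touched here. [OURS · L1 W4.3 · (o70-b) §6b] -/
theorem dominanceAtLevel_of_r₁_eq_r₂ (hdim : ringKrullDim S = (3 : ℕ)) {f : S} (hf0 : f ≠ 0) (hfm : f ∈ maximalIdeal S)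
    {a b : ℕ} (hb : 0 < b)
    (hbound : ∀ q' r₁' r₂' : ℕ, AdmissibleTriple q' r₁' r₂' → FlagReaches f (adicOrder f).toNat q' r₁' r₂' → r₁' * b ≤ a * r₂')
    {g₁ g₂ g₁' g₂' : S} {q r₁ r₂ : ℕ} (hadm : AdmissibleTriple q r₁ r₂) (hab : r₁ * b = a * r₂) (hrr : r₁ = r₂)
    (hΦ : IsTwoFlag g₁ g₂) (hΦ' : IsTwoFlag g₁' g₂')
    (hF : f ∈ flagContactFiltration g₁ g₂ q r₁ r₂ (r₁ * (adicOrder f).toNat))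
    (hF' : f ∈ flagContactFiltration g₁' g₂' q r₁ r₂ (r₁ * (adicOrder f).toNat)) :
    g₁' ∈ flagContactFiltration g₁ g₂ q r₁ r₂ r₁ ∧ g₂' ∈ flagContactFiltration g₁ g₂ q r₁ r₂ r₂ := by
  subst hrr
  obtain ⟨hν, -, hford⟩ := EssSmoothLevels.adicOrder_toNat_spec hf0 hfm
  set ν := (adicOrder f).toNat with hνdef
  have hr0 : 0 < r₁ := lt_of_lt_of_le hadm.1 hadm.2.1
  have hab' : a = b := by
    have h1 : r₁ * b = r₁ * a := by rw [hab, mul_comm]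
    exact (Nat.eq_of_mul_eq_mul_left hr0 h1).symm
  -- the unit-coefficient hypothesis from the ratio bound
  have hNP : ∀ ℓ ∈ maximalIdeal S, f ∉ Ideal.span {ℓ ^ ν} ⊔ maximalIdeal S ^ (ν + 1) := by
    intro ℓ hℓ hmem
    by_cases hℓ2 : ℓ ∈ maximalIdeal S ^ 2
    · apply hford
      have hle : Ideal.span {ℓ ^ ν} ≤ maximalIdeal S ^ (ν + 1) := by
        rw [Ideal.span_singleton_le_iff_mem]
        have h := Ideal.pow_mem_pow hℓ2 ν
        rw [← pow_mul] at h
        exact Ideal.pow_le_pow_right (by omega) h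
      exact (sup_le hle le_rfl) hmem
    · obtain ⟨g, hflag⟩ := exists_isTwoFlag_of_not_mem_sq hdim hℓ hℓ2
      obtain ⟨c, hc, m, hm, hcm⟩ := Submodule.mem_sup.mp hmem
      obtain ⟨d, rfl⟩ := Ideal.mem_span_singleton'.mp hc
      have hreach : FlagReaches f ν ν (ν + 1) ν := by
        refine ⟨ℓ, g, hflag, ?_⟩
        have h := mul_mem_flagContactFiltration_of_weight (g₁ := ℓ) (g₂ := g) (r₁ := ν + 1) (r₂ := ν) (n := (ν + 1) * ν)
          (α := ν) (β := 0) (k := 0) hν (show d ∈ maximalIdeal S ^ 0 by rw [pow_zero, Ideal.one_eq_top]; trivial) (by simp)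
        have heq : ℓ ^ ν * g ^ 0 * d = d * ℓ ^ ν := by ring
        rw [heq] at h
        have hsum := Ideal.add_mem _ h
          (mem_flagContactFiltration_of_mem_pow (g₁ := ℓ) (g₂ := g) (r₁ := ν + 1) (r₂ := ν) hν hm (le_of_eq (mul_comm _ _)))
        rwa [hcm] at hsum
      have h := hbound _ _ _ ⟨hν, le_rfl, Nat.le_succ _⟩ hreach
      rw [hab'] at h
      have h2 : (ν + 1) * b = ν * b + b := by ring
      rw [h2, mul_comm b] at h
      omega
  exact dominance_ratio_one hdim hNP hadm.1 hadm.2.1 hΦ hΦ' hF hF'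

end Word

end Iota3

end Summit.ResolutionOfSingularities.ResolutionOfSingularities.Cruxes.HypersurfaceCentreConstruction.LocalEngine

end
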